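import Mathlib.Data.Nat.Choose.Basic
import Literature.NumberTheory.EllipticCurves.KuriharaCertificates.Schema
import HarnessLib

/-!
# Kurihara numbers from TWISTED `L`-VALUES — the record schema of the cell's third implementation
# (modular-symbol-free) and its in-kernel recheck

Cell `b2b-bsdres` (BSD rank `≤ 1` residual classes), supersingular family, prover A = unit `b2b-bsdres-x10b`
(gen 8).  Topic file under `Summits/BirchSwinnertonDyer/Rank1Residual/Supersingular/`; namespace
`Summit.BirchSwinnertonDyer.Rank1Residual.Supersingular.KuriharaTwist`.

HONEST FRAMING (run/shared/lean/b2b/bsd-rank1-residual/, verbatim in every file): the goal of the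
cell is to DELETE the COMBINATION-SHAPED residual classes of the Birch–Swinnerton-Dyer formula for
ALL analytic-rank `≤ 1` elliptic curves over `ℚ` — "full BSD formula for every rank `≤ 1` curve in
class `C`" assembled STRICTLY from published theorems — so that the rank-`≤ 1` remainder becomes
exactly the CONSTRUCTION-SHAPED classes, which are TYPED (missing-input `Prop`s), NOT attempted.
This is not "finishing BSD".  This file is a DATA SCHEMA with a decidable recheck, exactly in the
spirit of `Literature/NumberTheory/EllipticCurves/KuriharaCertificates/Schema.lean` (whose helpers it
reuses); nothing here is a named fact, nothing is asserted about any elliptic curve, nothing is booked.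

## Why a second schema

The tree's Kurihara-number records (`KuriharaCertificates.Record`, files `Records*.lean`,
`Supersingular/X6KuriharaRecords*.lean`, …) store Kim's mod-`p` Kurihara number
`δ̃_n = ∑_{a ∈ (ℤ/n)ˣ} [a/n]⁺ · ∏_{ℓ ∣ n} log_{η_ℓ}(a) ∈ 𝔽_p` (C.-H. Kim, Amer. J. Math. = arXiv:2203.12159,
§1.4.3; lane CONVENTIONS.md §1–4: `[r]⁺ = x⁺{∞, r}/c_∞`, `x⁺` = PARI `msfromell` plus symbol normalised by
the least real period `ω₁`, `c_∞` = number of real components, `η_ℓ` = least primitive root, logarithms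
reduced mod `p`) together with the modular-symbol table it was summed from.  Both fleet implementations
(PARI `msfromell`; `msinit` + Hecke kernels) need the full space of modular symbols of level `N`, whose
memory cost (`ψ(N) = [SL₂(ℤ):Γ₀(N)] ≳ 1.05·10⁵` overflows 64 GB) leaves most supersingular residue pairs
with `2·10⁴ ≤ N < 5·10⁵` without any engine (HOME/b2b-bsdres-x10b/X6-KURIHARA.md §7: 96 X6 pairs).
The third implementation (`kurtw.py`, this seat, gen 8) never builds that space.  It computes instead the
`p` rational numbers

  `C_k := ∑_{a ∈ (ℤ/n)ˣ, m(a) ≡ k (mod p)} x⁺{∞, a/n}`,  `k = 0, …, p − 1`,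
  `m(a) := ∑_{ℓ ∣ n} log_{η_ℓ}(a mod ℓ) (mod p)`,

("character bins" of the plus symbol), from which `δ̃_n` is an elementary combination (next paragraph),
and it obtains the `C_k` from TWISTED CENTRAL `L`-VALUES: with `ζ = e^{2πi/p}`, `ψ_ℓ(η_ℓ) = ζ` and
`χ = ∏_ℓ ψ_ℓ` (a primitive even Dirichlet character mod `n` of order `p`), Birch's formula
(Mazur–Tate–Teitelbaum (8.6); Wiersema–Wuthrich, Doc. Math. 2022, Lemma 2) reads
`S_j := ∑_a χ^j(a) x⁺{∞, a/n} = τ(χ^j) · L(E, χ^{-j}, 1)/ω₁` (`τ` = Gauss sum) for `p ∤ j`, and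
`S_0 = ∏_{ℓ ∣ n}(a_ℓ − 2) · L(E,1)/ω₁` (Hecke), whence `C_k = p⁻¹ ∑_{j mod p} ζ^{-jk} S_j`.  The engine
evaluates `L(E, χ^{-j}, 1)` by the exponentially convergent series at the centre (conductor `N n²`, twist
root number `w_E χ^{-j}(N) τ(χ^{-j})²/n`, evaluated at two splitting points whose agreement validates the
functional equation used), in extended precision, and — for small `N n²` — a second time by PARI's
`lfun ∘ lfuntwist`; it then ROUNDS `D · C_k` to integers for the least admissible common denominator `D`
(all `p` values at once; the rounding margin, typically `10⁻¹³`, is recorded per level).  On every level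
where a modular-symbol table exists the bins agree EXACTLY with the table's bins (gen-8 calibration:
HOME/b2b-bsdres-x10b/X6-KURIHARA.md §8).

## From the bins to `δ̃_n` (the identity the recheck uses)

Put `e_t := ∑_k binom(k, t) · C_k` (`t ≥ 0`) and `ν = ν(n)`.  For Kolyvagin primes (`ℓ ≡ 1`,
`a_ℓ ≡ ℓ + 1 ≡ 2 (mod p)`) and `p ≥ 5`:

  `e_t ≡ 0 (mod p)` for `t < ν`,   and   `e_ν ≡ c_∞ · δ̃_n (mod p)`.

Proof sketch (elementary): `χ(θ_n) = ∑_a x⁺{∞,a/n} ζ^{m(a)} = ∑_t e_t π^t` with `π = ζ − 1`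
(binomial expansion of `(1+π)^{m(a)}`); on the other hand, expanding `∏_ℓ (1+π)^{log_ℓ a}` and using
the distribution (Hecke) relation `∑_{a ≡ a₁ (ℓ₁)} x⁺{∞, a/n} = a_{ℓ₂} x⁺{∞, a₁/ℓ₁} − x⁺{∞, ℓ₂a₁/ℓ₁}
− x⁺{∞, ℓ₂⁻¹a₁/ℓ₁}` together with `binom(m−u, 2) + binom(m+u, 2) = 2·binom(m, 2) + u²`, every
coefficient of total log-degree `< ν` is a multiple of some `a_ℓ − 2 ≡ 0`, and the coefficient of
`∏_ℓ log_ℓ(a)` is `∑_a x⁺ ∏ log_ℓ(a) = c_∞ δ̃_n`; the mixed terms of degree `ν` other than the product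
again carry a factor `a_ℓ − 2`.  (Equivalently: `v_π(χ(θ_n)) = ν` iff `δ̃_n` is a unit — the
Mazur–Tate "order of vanishing" reading.)  The identity was checked exactly on impl-1 tables before any
numerics (43314b1 @ 5, five levels) and is re-validated on every calibrated level.

So a record below stores `(D, [D·C_0, …, D·C_{p−1}])` and `deltaModP`, and `TwistRecord.consistent`
RECOMPUTES `δ̃_n ≡ c_∞⁻¹ D⁻¹ e_ν (mod p)` from the bins and demands (i) agreement with `deltaModP`,
(ii) the structure congruences `e_t ≡ 0 (mod p)`, `t < ν` (which test the whole pipeline, since a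
numerical or rounding error would violate them with probability `≈ 1 − p^{−ν}`).  What the record
CLAIMS about the curve is the same as for a `KuriharaCertificates.Record` with the same
`(label, p, n, roots, components, deltaModP)`: `δ̃_n ≢ 0 (mod p)`, i.e. the hypothesis `hδ` of the
cell's consumers `Supersingular.X6.bsdp_of_kim_rankZero_of_kuriharaNumber_ne_zero` /
`Supersingular.X7.bsdp_of_kim_rank{Zero,One}_of_kuriharaNumber_ne_zero` (Kim 2026 Thm. 1.8 (6)), up to
the period-transfer unit of `Kim2022_kuriharaNumber_certificate`.  The numerical step (twisted
`L`-values → rounded bins) is outside the kernel, as `msfromell` is for the first schema; its evidence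
(job, engine hash, margin, two-point check, `lfun` agreement, agreeing implementations) is carried in
the `evidence` strings of each record and in the generated files' docstrings.

## Design

Plain computable data; `decide` runs the recheck in the kernel (no `native_decide`, no axioms); the
modular-inverse helper is `KuriharaCertificates.invModPrime` (reused, not re-declared).  `CertifiedL rs`
is a `Prop` with a `Decidable` instance and the same unpacking lemmas as `KuriharaCertificates.Certified`.
Not here: primality / primitive-root / Kolyvagin checks (they need the curve), and the data (files
`Supersingular/*KuriharaTwistRecords*.lean`).

References: C.-H. Kim, arXiv:2203.12159 §1.4.1–§1.4.3, Thm. 1.9 (6) [Kim2022StructureSelmer];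
B. Mazur, J. Tate, J. Teitelbaum, Invent. Math. 84 (1986) §8 (Birch's formula (8.6));
H. Wiersema, C. Wuthrich, *Integrality of twisted L-values of elliptic curves*, Doc. Math. 27 (2022)
§2; C. Wuthrich, *Numerical modular symbols for elliptic curves*, Math. Comp. 87 (2018) (the other
modular-symbol-space-free method); lane CONVENTIONS.md (run/shared/lean/speedrun/kurihara/);
HOME/b2b-bsdres-x10b/X6-KURIHARA.md §8 (gen 8: engine, calibration, campaign).
-/

namespace Summit.BirchSwinnertonDyer.Rank1Residual.Supersingular.KuriharaTwist

open Literature.NumberTheory.EllipticCurves.KuriharaCertificates (invModPrime)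

/-- One level of the third implementation: the DATA `(D, D·C_0, …, D·C_{p−1})` of the character bins
`C_k = ∑_{a ∈ (ℤ/n)ˣ, ∑_ℓ log_{η_ℓ}(a) ≡ k (p)} x⁺{∞, a/n}` of the plus modular symbol of the curve `label`
at level `n = ∏ primes`, obtained from twisted central `L`-values (module docstring), with the computed
residue `deltaModP` of Kim's `δ̃_n`.  A record asserts nothing by itself; `TwistRecord.consistent` /
`TwistRecord.nonvanishing` are its decidable recheck predicates.
[cite: Kim2022StructureSelmer, §1.4.3 (PDF p. 7)] -/
structure TwistRecord where
  /-- Cremona label of the (optimal) curve. -/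
  label : String
  /-- a-invariants `[a₁, a₂, a₃, a₄, a₆]` of the reduced global minimal model. -/
  ainvs : List ℤ
  /-- the conductor `N`. -/
  conductor : ℕ
  /-- the prime `p` (`δ̃_n ∈ 𝔽_p`); the recheck requires `p ≥ 5`. -/
  p : ℕ
  /-- the square-free level `n = ∏ primes`, `n > 1`. -/
  n : ℕ
  /-- the Kolyvagin primes `ℓ ∣ n`, increasing. -/
  primes : List ℕ
  /-- `roots[i]` = the least primitive root `η_ℓ` modulo `primes[i]` (the base of the logarithms). -/
  roots : List ℕ
  /-- `c_∞` = number of connected components of `E(ℝ)` (`1` or `2`). -/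
  components : ℕ
  /-- Mordell–Weil rank of `E(ℚ)` (Cremona's tables; `=` analytic rank for these curves). -/
  rank : ℕ
  /-- reduction type of `E` at `p` (`"good-supersingular"` in this cell's files). -/
  reduction : String
  /-- the common denominator `D ≥ 1` of the bins (`p ∤ D`). -/
  den : ℕ
  /-- the integers `D·C_0, …, D·C_{p−1}` (length `p`). -/
  bins : List ℤ
  /-- the computed residue of `δ̃_n` in `[0, p)`. -/
  deltaModP : ℕ
  /-- provenance strings (documentation only): job, engine version / sha256, rounding margin, two-point
  check, `lfun` agreement, `m₀`, agreeing implementations. -/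
  evidence : List String
  deriving DecidableEq

/-- `D · e_t = ∑_k binom(k, t) · (D·C_k)`, the `t`-th binomial moment of the bins (module docstring).
[folklore] -/
def TwistRecord.moment (r : TwistRecord) (t : ℕ) : ℤ :=
  ((List.range r.bins.length).zip r.bins).foldl (fun acc kb => acc + (Nat.choose kb.1 t : ℤ) * kb.2) 0

/-- `δ̃_n mod p` RECOMPUTED from the bins: `c_∞⁻¹ · D⁻¹ · e_ν (mod p)` with `ν = #primes` (module
docstring, "From the bins to `δ̃_n`"; requires `p` prime, `p ∤ D c_∞`). [cite: Kim2022StructureSelmer, §1.4.3 (PDF p. 7)] -/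
def TwistRecord.deltaRecomputed (r : TwistRecord) : ℕ :=
  (r.moment r.primes.length % (r.p : ℤ)).toNat * invModPrime r.p r.den % r.p
    * invModPrime r.p r.components % r.p

/-- Internal consistency of a twist record (decidable, `Bool`-valued): five a-invariants; `n = ∏ primes > 1`
with `primes` duplicate-free and non-empty, `#roots = #primes`, every `ℓ ≡ 1 (mod p)`; `p ≥ 5`;
`components ∈ {1, 2}`; exactly `p` bins; `p ∤ D`, `D ≥ 1`; `deltaModP < p`; the STRUCTURE CONGRUENCES
`e_t ≡ 0 (mod p)` for all `t < ν`; and the recomputation `deltaRecomputed = deltaModP`.  (Primality of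
`p`, `ℓ`, primitivity of the roots and `a_ℓ ≡ 2 (mod p)` are NOT checked here.) [folklore] -/
def TwistRecord.consistent (r : TwistRecord) : Bool :=
  (r.ainvs.length == 5) &&
  (r.primes.foldl (· * ·) 1 == r.n) && (1 < r.n) && r.primes.Nodup && (0 < r.primes.length) &&
  (r.roots.length == r.primes.length) && r.primes.all (fun ℓ => ℓ % r.p == 1) && (5 ≤ r.p) &&
  (r.components == 1 || r.components == 2) &&
  (r.bins.length == r.p) && (r.den % r.p != 0) && (0 < r.den) && (r.deltaModP < r.p) &&
  (List.range r.primes.length).all (fun t => r.moment t % (r.p : ℤ) == 0) &&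
  (r.deltaRecomputed == r.deltaModP)

/-- A twist record is a NON-VANISHING CERTIFICATE when it is consistent and `deltaModP ≠ 0`, i.e. it
records `δ̃_n ≢ 0 (mod p)`. [folklore] -/
def TwistRecord.nonvanishing (r : TwistRecord) : Bool := r.consistent && (0 < r.deltaModP)

/-- A list of twist records is `CertifiedL` when every one of them is a non-vanishing certificate; this is
the statement of each generated per-curve theorem `certL_<class>_<label>_p<p> : CertifiedL [ … ]` of the files
`Supersingular/*KuriharaTwistRecords*.lean`, proved by `decide` (the kernel re-runs the recheck). [folklore] -/
def CertifiedL (rs : List TwistRecord) : Prop := rs.all TwistRecord.nonvanishing = true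

/-- `CertifiedL rs` is decidable (a `Bool` equation). [folklore] -/
instance CertifiedL.instDecidable (rs : List TwistRecord) : Decidable (CertifiedL rs) :=
  inferInstanceAs (Decidable (rs.all TwistRecord.nonvanishing = true))

/-- Unpacking `CertifiedL`: every listed record is a non-vanishing certificate. [folklore] -/
theorem CertifiedL.nonvanishing_of_mem {rs : List TwistRecord} (h : CertifiedL rs) {r : TwistRecord}
    (hr : r ∈ rs) : r.nonvanishing = true :=
  List.all_eq_true.1 h r hr

/-- Unpacking `CertifiedL`: every listed record is consistent (in particular its structure congruences
hold and the kernel's recomputation of `δ̃_n mod p` from the bins equals `deltaModP`). [folklore] -/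
theorem CertifiedL.consistent_of_mem {rs : List TwistRecord} (h : CertifiedL rs) {r : TwistRecord}
    (hr : r ∈ rs) : r.consistent = true := by
  have := h.nonvanishing_of_mem hr
  simp only [TwistRecord.nonvanishing, Bool.and_eq_true] at this
  exact this.1

/-- Unpacking `CertifiedL`: every listed record has `0 < deltaModP`. [folklore] -/
theorem CertifiedL.deltaModP_pos_of_mem {rs : List TwistRecord} (h : CertifiedL rs) {r : TwistRecord}
    (hr : r ∈ rs) : 0 < r.deltaModP := by
  have := h.nonvanishing_of_mem hr
  simp only [TwistRecord.nonvanishing, Bool.and_eq_true, decide_eq_true_eq] at this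
  exact this.2

/-- `CertifiedL` of a `cons` is the head's certificate together with `CertifiedL` of the tail. [folklore] -/
theorem CertifiedL.cons_iff (r : TwistRecord) (rs : List TwistRecord) :
    CertifiedL (r :: rs) ↔ r.nonvanishing = true ∧ CertifiedL rs := by
  simp [CertifiedL, List.all_cons]

/-- The empty list is certified (vacuously). [folklore] -/
theorem CertifiedL.nil : CertifiedL [] := by decide

/-- SAMPLE (and regression test of the recheck) on a level that carries ALL THREE implementations:
`43314b1` @ `5`, `n = 10291 = 41·251`, `η = (6, 6)`, `c_∞ = 2`: the bins of the impl-1 exact table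
(kit j102415, table sha256 `b92b3df03437…`, = impl 2 j102669) are `C = (2134, −2968, 2134, −650, −650)`
(`D = 1`), reproduced exactly by the twisted-`L`-value engine (kit j107960); `e_0 = 0`, `e_1 = −3250 ≡ 0`,
`e_2 = −3716 ≡ 4`, `δ̃ ≡ 2⁻¹·4 ≡ 2 (mod 5)` = the recorded `deltaModP` of all three implementations (the
kernel re-derives it below). [cite: Kim2022StructureSelmer, §1.4.3 (PDF p. 7)] -/
theorem certifiedL_sample : CertifiedL [
  { label := "43314b1", ainvs := [1, 1, 0, -2916550, -1916874476], conductor := 43314, p := 5, n := 10291,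
    primes := [41, 251], roots := [6, 6], components := 2, rank := 0, reduction := "good-supersingular",
    den := 1, bins := [2134, -2968, 2134, -650, -650], deltaModP := 2,
    evidence := ["impl1 j102415 = impl2 j102669 = impl3 j107960 (bins exact match)"] } ] := by
  decide

/-- Tampering is caught: the sample record with `deltaModP` changed from `2` to `3` is NOT certified (the
kernel recomputation from the bins gives `2`). [folklore] -/
theorem not_certifiedL_tampered : ¬ CertifiedL [
  { label := "43314b1", ainvs := [1, 1, 0, -2916550, -1916874476], conductor := 43314, p := 5, n := 10291,
    primes := [41, 251], roots := [6, 6], components := 2, rank := 0, reduction := "good-supersingular",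
    den := 1, bins := [2134, -2968, 2134, -650, -650], deltaModP := 3,
    evidence := [] } ] := by
  decide

/-- A corrupted bin is caught by the STRUCTURE congruence: changing `D·C_1` of the sample from `−2968` to
`−2967` breaks `e_1 ≡ 0 (mod 5)`, so the record is not certified whatever `deltaModP` says. [folklore] -/
theorem not_certifiedL_corrupted_bin : ¬ CertifiedL [
  { label := "43314b1", ainvs := [1, 1, 0, -2916550, -1916874476], conductor := 43314, p := 5, n := 10291,
    primes := [41, 251], roots := [6, 6], components := 2, rank := 0, reduction := "good-supersingular",
    den := 1, bins := [2134, -2967, 2134, -650, -650], deltaModP := 2,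
    evidence := [] } ] := by
  decide

end Summit.BirchSwinnertonDyer.Rank1Residual.Supersingular.KuriharaTwist
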